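import Literature.Topology.FourManifolds.CircleDiffeotopyProofs
import Mathlib.Analysis.SpecialFunctions.SmoothTransition
import Mathlib.Geometry.Manifold.MFDeriv.Atlas
import Mathlib.Geometry.Manifold.Algebra.LieGroup
import HarnessLib

/-!
# One-parameter families of circles in a manifold: θ-velocity, arcs and bumps on `S¹`, and
# perturbation in a chart

Topic `Literature/Topology/FourManifolds`; infrastructure for the tree's proof of Whitney's
theorem *homotopic smoothly embedded circles in a manifold of dimension `≥ 4` are smoothly
isotopic* (H. Whitney, *Differentiable manifolds*, Ann. of Math. 37 (1936), Thm. 6 of §II with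
the general-position arguments of §§8–9; Milnor, *Lectures on the h-cobordism theorem* (1965),
Thm. 8.4 and Remark, PDF p. 56), which discharges the leaf
`Literature.Topology.FourManifolds.Milnor1965_isAmbientIsotopic_of_simplyConnected` of
`HCobordismAuxiliaryPair.lean`.  The proof perturbs a smooth homotopy `G : ℝ × S¹ → V`
rectangle by rectangle inside charts of `V`, by generic small affine terms.  This file sets up
the objects of that argument; everything here is proved (definitions with their API, no named
facts):

* `Literature.Topology.FourManifolds.thetaCurve`, `Literature.Topology.FourManifolds.thetaVel` —
  the lifted circle `s ↦ G (t, circlePoint s)` at time `t` and its velocity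
  `thetaVel n G t s ∈ T V = ℝⁿ` (a manifold derivative); `Literature.Topology.FourManifolds.StagesGoodOn n G A`
  — on `A ⊆ ℝ × S¹` the stages of `G` have nowhere zero θ-velocity and separate the points of
  `A` from all other points of the same stage (the inductive invariant of the general-position
  argument); the **chart bridge** `hasDerivAt_extChartAt_thetaCurve` /
  `thetaVel_eq_zero_iff_deriv_eq_zero`: in an extended chart `φ` of `V` the θ-velocity vanishes
  iff the ordinary derivative of `s ↦ φ (G (t, circlePoint s))` does
  (`isInvertible_mfderiv_extChartAt`).
* `Literature.Topology.FourManifolds.angCos c`, `Literature.Topology.FourManifolds.angSin c` —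
  the functions `cos (θ - c)`, `sin (θ - c)` of the angle as smooth functions on `S¹`
  (inner products with `circlePoint c`, `circlePoint (c + π/2)`), the open and closed arcs
  `Literature.Topology.FourManifolds.circleArc c α = {cos α < angCos c}`,
  `Literature.Topology.FourManifolds.circleClosedArc c α = {cos α ≤ angCos c}`, and their lifts: `circleArc c α`
  is parametrised injectively by the angles `θ` with `|θ - c| < α` (`α ≤ π`).
* `Literature.Topology.FourManifolds.plateauBump`, `Literature.Topology.FourManifolds.angBump`,
  `Literature.Topology.FourManifolds.rectBump τ δ c α` — smooth bumps (from Mathlib's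
  `Real.smoothTransition`) on `ℝ`, on `S¹`, and on `ℝ × S¹`: `rectBump` is `1` on the compact
  rectangle `[τ - δ, τ + δ] × circleClosedArc c α` and `0` off `(τ - 2δ, τ + 2δ) × circleArc c (2α)`.
* `Literature.Topology.FourManifolds.chartPerturb G x ρ ℓ q` — the family `G` perturbed inside
  the extended chart at `x : V` by the affine term `ρ p • (v + ℓ p.2 • w)`, `q = (v, w)`:
  `p ↦ φ⁻¹ (φ (G p) + ρ p • (v + ℓ p.2 • w))` where `ρ p ≠ 0`, and `G p` elsewhere; it is
  smooth when `G` maps an open set `R ⊇ tsupport ρ` into the chart source and the perturbed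
  coordinates stay in the chart target (`contMDiff_chartPerturb`).

## References

* H. Whitney, *Differentiable manifolds*, Ann. of Math. (2) 37 (1936), 645–680, §II Thm. 6,
  §§8–9. [Whitney1936]
* J. Milnor, *Lectures on the h-cobordism theorem* (1965), Thm. 8.4 and Remark (PDF p. 56 of
  the held copy `book:milnornd-lectures-h-cobordism-theorem`). [MilnorHCobordism1965]
* M. W. Hirsch, *Differential Topology*, GTM 33 (1976), Ch. 3 §2 (Thm. 2.5), Ch. 8 §1 Ex. 14.
  [HirschDT1976]
-/

open scoped Manifold ContDiff Topology Real RealInnerProductSpace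
open Function Set Filter

noncomputable section

namespace Literature.Topology.FourManifolds

/-- Local notation: `𝔼 n` is the model Euclidean space `EuclideanSpace ℝ (Fin n)`. -/
local notation "𝔼 " n:arg => EuclideanSpace ℝ (Fin n)

/-- Local notation: `𝕊 n` is the unit sphere in `EuclideanSpace ℝ (Fin (n + 1))`. -/
local notation "𝕊 " n:arg => (Metric.sphere (0 : EuclideanSpace ℝ (Fin (n + 1))) 1)

attribute [local instance] fact_finrank_euclideanSpace_two

variable {n : ℕ} {V : Type*}

/-! ### The θ-velocity of a family of circles and the good-set predicate -/

section Lift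

/-- The **lifted circle at time `t`** of a family `G : ℝ × S¹ → V`: `s ↦ G (t, circlePoint s)`
(reducible, so that `thetaCurve G t s` and `G (t, circlePoint s)` are interchangeable). [folklore] -/
abbrev thetaCurve (G : ℝ × 𝕊 1 → V) (t : ℝ) : ℝ → V := fun s => G (t, circlePoint s)

/-- Unfolding of `thetaCurve`. [folklore] -/
@[simp]
theorem thetaCurve_apply (G : ℝ × 𝕊 1 → V) (t s : ℝ) :
    thetaCurve G t s = G (t, circlePoint s) := rfl

/-- The lifted circle of a family agreeing with `G` near `(t, circlePoint s)` agrees with that of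
`G` near `s`. [folklore] -/
theorem thetaCurve_eventuallyEq {G G' : ℝ × 𝕊 1 → V} {t s : ℝ}
    (h : G' =ᶠ[𝓝 (t, circlePoint s)] G) : thetaCurve G' t =ᶠ[𝓝 s] thetaCurve G t := by
  have hc : ContinuousAt (fun r : ℝ => ((t, circlePoint r) : ℝ × 𝕊 1)) s :=
    (continuousAt_const.prodMk continuous_circlePoint.continuousAt)
  exact hc.eventually h

end Lift

section ThetaVel

variable [TopologicalSpace V] [ChartedSpace (𝔼 n) V]

variable (n) in
/-- The **θ-velocity** of the family `G` at `(t, circlePoint s)`: the manifold derivative of the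
lifted circle `thetaCurve G t` at `s`, applied to `1`, a vector of `T_{G (t, circlePoint s)} V = ℝⁿ`
(the model dimension `n` of `V` is an explicit argument). [folklore] -/
def thetaVel (G : ℝ × 𝕊 1 → V) (t s : ℝ) : 𝔼 n :=
  mfderiv 𝓘(ℝ, ℝ) (𝓡 n) (thetaCurve G t) s (1 : ℝ)

/-- Unfolding of `thetaVel`. [folklore] -/
theorem thetaVel_def (G : ℝ × 𝕊 1 → V) (t s : ℝ) :
    thetaVel n G t s = mfderiv 𝓘(ℝ, ℝ) (𝓡 n) (thetaCurve G t) s (1 : ℝ) := rfl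

variable (n) in
/-- **The good-set predicate.**  `StagesGoodOn n G A`: at every point `(t, circlePoint s)` of `A` the
θ-velocity of `G` is nonzero, and every point `(t, u)` of `A` is separated by the stage `G (t, ·)`
from all other points `u' ≠ u` of the circle.  For `A = univ` this says that every stage is an
injective map with nowhere vanishing velocity. [folklore] -/
def StagesGoodOn (G : ℝ × 𝕊 1 → V) (A : Set (ℝ × 𝕊 1)) : Prop :=
  (∀ t s : ℝ, (t, circlePoint s) ∈ A → thetaVel n G t s ≠ 0) ∧
    ∀ (t : ℝ) (u u' : 𝕊 1), (t, u) ∈ A → G (t, u) = G (t, u') → u = u'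

/-- `StagesGoodOn` is antitone in the set. [folklore] -/
theorem StagesGoodOn.mono {G : ℝ × 𝕊 1 → V} {A B : Set (ℝ × 𝕊 1)} (h : StagesGoodOn n G A) (hBA : B ⊆ A) :
    StagesGoodOn n G B :=
  ⟨fun t s hs => h.1 t s (hBA hs), fun t u u' hu => h.2 t u u' (hBA hu)⟩

/-- `StagesGoodOn` on a union. [folklore] -/
theorem StagesGoodOn.union {G : ℝ × 𝕊 1 → V} {A B : Set (ℝ × 𝕊 1)} (hA : StagesGoodOn n G A)
    (hB : StagesGoodOn n G B) : StagesGoodOn n G (A ∪ B) :=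
  ⟨fun t s hs => hs.elim (hA.1 t s) (hB.1 t s),
    fun t u u' hu => hu.elim (hA.2 t u u') (hB.2 t u u')⟩

/-- `StagesGoodOn n G univ` gives injective stages. [folklore] -/
theorem StagesGoodOn.injective_stage {G : ℝ × 𝕊 1 → V} (h : StagesGoodOn n G univ) (t : ℝ) :
    Injective fun u : 𝕊 1 => G (t, u) :=
  fun u u' huu' => h.2 t u u' (mem_univ _) huu'

/-- The θ-velocity only depends on the germ of the family. [folklore] -/
theorem thetaVel_congr_of_eventuallyEq {G G' : ℝ × 𝕊 1 → V} {t s : ℝ}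
    (h : G' =ᶠ[𝓝 (t, circlePoint s)] G) : thetaVel n G' t s = thetaVel n G t s := by
  unfold thetaVel
  exact congrArg (fun L : ℝ →L[ℝ] 𝔼 n => L 1) (thetaCurve_eventuallyEq h).mfderiv_eq

/-- If two families agree on stages, `G' (t, ·) = G (t', ·)`, their θ-velocities agree.
[folklore] -/
theorem thetaVel_eq_of_stage_eq {G : ℝ × 𝕊 1 → V} {G' : ℝ × 𝕊 1 → V} {t t' : ℝ}
    (h : ∀ u, G' (t, u) = G (t', u)) (s : ℝ) : thetaVel n G' t s = thetaVel n G t' s := by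
  have : thetaCurve G' t = thetaCurve G t' := funext fun r => h _
  rw [thetaVel_def, thetaVel_def, this]

/-- The lifted circles of a smooth family are smooth curves. [folklore] -/
theorem contMDiff_thetaCurve {G : ℝ × 𝕊 1 → V}
    (hG : ContMDiff (𝓘(ℝ, ℝ).prod (𝓡 1)) (𝓡 n) ∞ G) (t : ℝ) :
    ContMDiff 𝓘(ℝ, ℝ) (𝓡 n) ∞ (thetaCurve G t) :=
  hG.comp (contMDiff_const.prodMk contMDiff_circlePoint)

variable [IsManifold (𝓡 n) ∞ V]

set_option backward.isDefEq.respectTransparency false in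
/-- **Chart bridge.**  For a smooth family `G` and a point with `G (t, circlePoint s)` in the
source of the chart at `x`, the curve `r ↦ φ (G (t, circlePoint r))` read in the extended chart
`φ` at `x` has derivative `dφ (thetaVel n G t s)` at `s`.  (The identification
`T ℝⁿ = ℝⁿ` is by definitional unfolding of `TangentSpace`, whence the transparency option, as
in Mathlib's `NormedSpace.fromTangentSpace`.) [folklore] -/
theorem hasDerivAt_extChartAt_thetaCurve {G : ℝ × 𝕊 1 → V}
    (hG : ContMDiff (𝓘(ℝ, ℝ).prod (𝓡 1)) (𝓡 n) ∞ G) {x : V} {t s : ℝ}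
    (hs : G (t, circlePoint s) ∈ (chartAt (𝔼 n) x).source) :
    HasDerivAt (fun r => extChartAt (𝓡 n) x (G (t, circlePoint r)))
      (mfderiv (𝓡 n) 𝓘(ℝ, 𝔼 n) (extChartAt (𝓡 n) x) (G (t, circlePoint s)) (thetaVel n G t s))
      s := by
  have hγ : HasMFDerivAt 𝓘(ℝ, ℝ) (𝓡 n) (thetaCurve G t) s
      (mfderiv 𝓘(ℝ, ℝ) (𝓡 n) (thetaCurve G t) s) :=
    ((contMDiff_thetaCurve hG t s).mdifferentiableAt (by simp)).hasMFDerivAt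
  have hφ : HasMFDerivAt (𝓡 n) 𝓘(ℝ, 𝔼 n) (extChartAt (𝓡 n) x) (thetaCurve G t s)
      (mfderiv (𝓡 n) 𝓘(ℝ, 𝔼 n) (extChartAt (𝓡 n) x) (G (t, circlePoint s))) :=
    hasMFDerivAt_extChartAt (I := 𝓡 n) hs
  have hcomp := hφ.comp s hγ
  have hF := hasMFDerivAt_iff_hasFDerivAt.mp hcomp
  exact hF.hasDerivAt

/-- **Chart bridge, zero form.**  For a smooth family `G` and a point with `G (t, circlePoint s)`
in the source of the chart at `x`: the θ-velocity vanishes iff the derivative of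
`r ↦ φ (G (t, circlePoint r))` vanishes (`dφ` is invertible on the chart source,
`isInvertible_mfderiv_extChartAt`). [folklore] -/
theorem thetaVel_eq_zero_iff_deriv_eq_zero {G : ℝ × 𝕊 1 → V}
    (hG : ContMDiff (𝓘(ℝ, ℝ).prod (𝓡 1)) (𝓡 n) ∞ G) {x : V} {t s : ℝ}
    (hs : G (t, circlePoint s) ∈ (chartAt (𝔼 n) x).source) :
    thetaVel n G t s = 0 ↔
      deriv (fun r => extChartAt (𝓡 n) x (G (t, circlePoint r))) s = 0 := by
  rw [(hasDerivAt_extChartAt_thetaCurve hG hs).deriv]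
  set L := mfderiv (𝓡 n) 𝓘(ℝ, 𝔼 n) (extChartAt (𝓡 n) x) (G (t, circlePoint s)) with hL
  have hinv : L.IsInvertible := isInvertible_mfderiv_extChartAt (I := 𝓡 n) (x := x)
    (y := G (t, circlePoint s)) (by rwa [extChartAt_source])
  constructor
  · intro h
    exact (congrArg L h).trans (map_zero L)
  · intro h
    exact hinv.injective (h.trans (map_zero L).symm)

end ThetaVel

/-! ### Angle functions, arcs and their lifts -/

section Arcs

/-- Inner products of points of the circle: `⟪circlePoint a, circlePoint b⟫ = cos (a - b)`.
[folklore] -/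
theorem inner_circlePoint_circlePoint (a b : ℝ) :
    ⟪((circlePoint a : 𝕊 1) : 𝔼 2), ((circlePoint b : 𝕊 1) : 𝔼 2)⟫ = Real.cos (a - b) := by
  rw [PiLp.inner_apply, Fin.sum_univ_two]
  simp only [RCLike.inner_apply, conj_trivial, circlePoint_apply_zero, circlePoint_apply_one]
  rw [Real.cos_sub]
  ring

/-- **The cosine of the angle to `circlePoint c`**, as a function on the circle:
`angCos c u = ⟪u, circlePoint c⟫`, so `angCos c (circlePoint θ) = cos (θ - c)`. [folklore] -/
def angCos (c : ℝ) (u : 𝕊 1) : ℝ := ⟪(u : 𝔼 2), ((circlePoint c : 𝕊 1) : 𝔼 2)⟫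

/-- **The sine of the angle to `circlePoint c`**, as a function on the circle:
`angSin c u = ⟪u, circlePoint (c + π/2)⟫`, so `angSin c (circlePoint θ) = sin (θ - c)`. [folklore] -/
def angSin (c : ℝ) (u : 𝕊 1) : ℝ := ⟪(u : 𝔼 2), ((circlePoint (c + π / 2) : 𝕊 1) : 𝔼 2)⟫

/-- `angCos c (circlePoint θ) = cos (θ - c)`. [folklore] -/
@[simp]
theorem angCos_circlePoint (c θ : ℝ) : angCos c (circlePoint θ) = Real.cos (θ - c) :=
  inner_circlePoint_circlePoint θ c

/-- `angSin c (circlePoint θ) = sin (θ - c)`. [folklore] -/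
@[simp]
theorem angSin_circlePoint (c θ : ℝ) : angSin c (circlePoint θ) = Real.sin (θ - c) := by
  rw [angSin, inner_circlePoint_circlePoint, show θ - (c + π / 2) = (θ - c) - π / 2 by ring,
    Real.cos_sub_pi_div_two]

/-- `|angCos c u| ≤ 1`. [folklore] -/
theorem abs_angCos_le_one (c : ℝ) (u : 𝕊 1) : |angCos c u| ≤ 1 := by
  obtain ⟨θ, rfl⟩ := circlePoint_surjective u
  rw [angCos_circlePoint]
  exact Real.abs_cos_le_one _

/-- `|angSin c u| ≤ 1`. [folklore] -/
theorem abs_angSin_le_one (c : ℝ) (u : 𝕊 1) : |angSin c u| ≤ 1 := by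
  obtain ⟨θ, rfl⟩ := circlePoint_surjective u
  rw [angSin_circlePoint]
  exact Real.abs_sin_le_one _

/-- `angCos c` is smooth on the circle. [folklore] -/
theorem contMDiff_angCos (c : ℝ) : ContMDiff (𝓡 1) 𝓘(ℝ, ℝ) ∞ (angCos c) :=
  ((contDiff_id.inner ℝ contDiff_const).contMDiff).comp contMDiff_coe_sphere

/-- `angSin c` is smooth on the circle. [folklore] -/
theorem contMDiff_angSin (c : ℝ) : ContMDiff (𝓡 1) 𝓘(ℝ, ℝ) ∞ (angSin c) :=
  ((contDiff_id.inner ℝ contDiff_const).contMDiff).comp contMDiff_coe_sphere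

/-- `angCos c` is continuous. [folklore] -/
theorem continuous_angCos (c : ℝ) : Continuous (angCos c) := (contMDiff_angCos c).continuous

/-- `angSin c` is continuous. [folklore] -/
theorem continuous_angSin (c : ℝ) : Continuous (angSin c) := (contMDiff_angSin c).continuous

/-- **The open arc** of angular radius `α` about `circlePoint c`: `{u | cos α < angCos c u}`.
[folklore] -/
def circleArc (c α : ℝ) : Set (𝕊 1) := {u | Real.cos α < angCos c u}

/-- **The closed arc** of angular radius `α` about `circlePoint c`: `{u | cos α ≤ angCos c u}`.
[folklore] -/
def circleClosedArc (c α : ℝ) : Set (𝕊 1) := {u | Real.cos α ≤ angCos c u}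

/-- Membership in the open arc. [folklore] -/
@[simp]
theorem mem_circleArc {c α : ℝ} {u : 𝕊 1} : u ∈ circleArc c α ↔ Real.cos α < angCos c u := Iff.rfl

/-- Membership in the closed arc. [folklore] -/
@[simp]
theorem mem_circleClosedArc {c α : ℝ} {u : 𝕊 1} : u ∈ circleClosedArc c α ↔ Real.cos α ≤ angCos c u := Iff.rfl

/-- The open arc is open. [folklore] -/
theorem isOpen_circleArc (c α : ℝ) : IsOpen (circleArc c α) := isOpen_lt continuous_const (continuous_angCos c)

/-- The closed arc is closed. [folklore] -/
theorem isClosed_circleClosedArc (c α : ℝ) : IsClosed (circleClosedArc c α) :=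
  isClosed_le continuous_const (continuous_angCos c)

/-- The closed arc is compact. [folklore] -/
theorem isCompact_circleClosedArc (c α : ℝ) : IsCompact (circleClosedArc c α) := (isClosed_circleClosedArc c α).isCompact

/-- The open arc lies in the closed arc of the same radius. [folklore] -/
theorem circleArc_subset_carc (c α : ℝ) : circleArc c α ⊆ circleClosedArc c α := fun _ hu =>
  mem_circleClosedArc.2 (le_of_lt (mem_circleArc.1 hu))

/-- The open arc lies in the closed arc of the same radius (systematic name of
`circleArc_subset_carc`). [folklore] -/
theorem circleArc_subset_circleClosedArc (c α : ℝ) : circleArc c α ⊆ circleClosedArc c α :=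
  circleArc_subset_carc c α

/-- Monotonicity: a closed arc lies in any open arc of larger radius `≤ π`. [folklore] -/
theorem circleClosedArc_subset_arc {c α β : ℝ} (hα : 0 ≤ α) (hαβ : α < β) (hβ : β ≤ π) :
    circleClosedArc c α ⊆ circleArc c β := fun _ hu =>
  mem_circleArc.2 (lt_of_lt_of_le (Real.cos_lt_cos_of_nonneg_of_le_pi hα hβ hαβ) (mem_circleClosedArc.1 hu))

/-- Monotonicity: a closed arc lies in any open arc of larger radius `≤ π` (systematic name of
`circleClosedArc_subset_arc`). [folklore] -/
theorem circleClosedArc_subset_circleArc {c α β : ℝ} (hα : 0 ≤ α) (hαβ : α < β) (hβ : β ≤ π) :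
    circleClosedArc c α ⊆ circleArc c β :=
  circleClosedArc_subset_arc hα hαβ hβ

/-- The centre lies in the closed arc (`0 ≤ α`-free: `cos α ≤ 1`). [folklore] -/
theorem circlePoint_mem_circleClosedArc (c α : ℝ) : circlePoint c ∈ circleClosedArc c α := by
  rw [mem_circleClosedArc, angCos_circlePoint, sub_self, Real.cos_zero]
  exact Real.cos_le_one α

/-- Angles within `α ≤ π` of `c` give points of the open arc. [folklore] -/
theorem circlePoint_mem_circleArc {c α θ : ℝ} (hθ : |θ - c| < α) (hα : α ≤ π) :
    circlePoint θ ∈ circleArc c α := by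
  rw [mem_circleArc, angCos_circlePoint, ← Real.cos_abs (θ - c)]
  exact Real.cos_lt_cos_of_nonneg_of_le_pi (abs_nonneg _) hα hθ

/-- Angles within `≤ α ≤ π` of `c` give points of the closed arc. [folklore] -/
theorem circlePoint_mem_circleClosedArc_of_abs_le {c α θ : ℝ} (hθ : |θ - c| ≤ α) (hα : α ≤ π) :
    circlePoint θ ∈ circleClosedArc c α := by
  rw [mem_circleClosedArc, angCos_circlePoint, ← Real.cos_abs (θ - c)]
  exact Real.cos_le_cos_of_nonneg_of_le_pi (abs_nonneg _) hα hθ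

/-- **Lift of the open arc.**  Every point of `circleArc c α` (`0 ≤ α`) is `circlePoint θ` for an
angle with `|θ - c| < α`. [folklore] -/
theorem exists_abs_lt_of_mem_circleArc {c α : ℝ} {u : 𝕊 1} (hu : u ∈ circleArc c α) (hα0 : 0 ≤ α) :
    ∃ θ : ℝ, |θ - c| < α ∧ circlePoint θ = u := by
  obtain ⟨θ₀, rfl⟩ := circlePoint_surjective u
  -- reduce `θ₀ - c` modulo `2π` into `(-π, π]`
  set θ : ℝ := c + toIocMod Real.two_pi_pos (-π) (θ₀ - c) with hθ
  have hmem : θ - c ∈ Ioc (-π) (-π + 2 * π) := by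
    rw [hθ, add_sub_cancel_left]
    exact toIocMod_mem_Ioc _ _ _
  have hcp : circlePoint θ = circlePoint θ₀ := by
    rw [circlePoint_eq_circlePoint_iff]
    refine ⟨-toIocDiv Real.two_pi_pos (-π) (θ₀ - c), ?_⟩
    rw [hθ, toIocMod]
    push_cast
    ring
  refine ⟨θ, ?_, hcp⟩
  have hcos : Real.cos α < Real.cos (|θ - c|) := by
    have := hu
    rw [← hcp, mem_circleArc, angCos_circlePoint] at this
    rwa [Real.cos_abs]
  have habs : |θ - c| ≤ π := abs_le.2 ⟨le_of_lt hmem.1, by linarith [hmem.2]⟩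
  by_contra hnot
  exact absurd hcos (not_lt.2 (Real.cos_le_cos_of_nonneg_of_le_pi hα0 habs (le_of_not_gt hnot)))

/-- **Injectivity of the lift.**  Two angles within `α ≤ π` of `c` with the same point on the
circle are equal. [folklore] -/
theorem eq_of_circlePoint_eq_of_abs_lt {c α θ θ' : ℝ} (hθ : |θ - c| < α) (hθ' : |θ' - c| < α)
    (hα : α ≤ π) (h : circlePoint θ = circlePoint θ') : θ = θ' := by
  obtain ⟨k, hk⟩ := circlePoint_eq_circlePoint_iff.1 h
  have h1 : |θ - θ'| < 2 * π := by
    calc |θ - θ'| = |(θ - c) - (θ' - c)| := by ring_nf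
      _ ≤ |θ - c| + |θ' - c| := abs_sub _ _
      _ < α + α := add_lt_add hθ hθ'
      _ ≤ 2 * π := by linarith
  rw [hk, abs_mul, abs_of_pos Real.two_pi_pos] at h1
  have hk1 : |(k : ℝ)| < 1 := by
    by_contra hc
    have : (1 : ℝ) ≤ |(k : ℝ)| := le_of_not_gt hc
    nlinarith [Real.pi_pos]
  have hk0 : k = 0 := by
    rw [← Int.cast_abs] at hk1
    have : |k| < 1 := by exact_mod_cast hk1
    exact Int.abs_lt_one_iff.1 this
  rw [hk0] at hk
  simp only [Int.cast_zero, mul_zero] at hk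
  linarith

end Arcs

/-! ### Smooth bumps on `ℝ`, on the circle, and on `ℝ × S¹` -/

section Bumps

/-- **Plateau bump on `ℝ`** (`plateauBump`; not to be confused with the radial `Literature.Analysis.FluidPDE.plateauBump`): smooth, `= 1` on `[l, r]`, `= 0` off `(l - δ, r + δ)` (for `δ > 0`),
with values in `[0, 1]`; built from Mathlib's `Real.smoothTransition`. [folklore] -/
def plateauBump (l r δ : ℝ) (x : ℝ) : ℝ :=
  Real.smoothTransition ((x - l) / δ + 1) * Real.smoothTransition ((r - x) / δ + 1)

/-- The plateau bump is smooth. [folklore] -/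
theorem contDiff_plateauBump (l r δ : ℝ) : ContDiff ℝ ∞ (plateauBump l r δ) := by
  unfold plateauBump
  refine ContDiff.mul ?_ ?_
  · exact Real.smoothTransition.contDiff.comp
      (((contDiff_id.sub contDiff_const).div_const δ).add contDiff_const)
  · exact Real.smoothTransition.contDiff.comp
      (((contDiff_const.sub contDiff_id).div_const δ).add contDiff_const)

/-- The plateau bump is nonnegative. [folklore] -/
theorem plateauBump_nonneg (l r δ x : ℝ) : 0 ≤ plateauBump l r δ x :=
  mul_nonneg (Real.smoothTransition.nonneg _) (Real.smoothTransition.nonneg _)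

/-- The plateau bump is at most `1`. [folklore] -/
theorem plateauBump_le_one (l r δ x : ℝ) : plateauBump l r δ x ≤ 1 :=
  mul_le_one₀ (Real.smoothTransition.le_one _) (Real.smoothTransition.nonneg _)
    (Real.smoothTransition.le_one _)

/-- The plateau bump is `1` on `[l, r]`. [folklore] -/
theorem plateauBump_eq_one {l r δ x : ℝ} (hδ : 0 < δ) (hl : l ≤ x) (hr : x ≤ r) :
    plateauBump l r δ x = 1 := by
  unfold plateauBump
  rw [Real.smoothTransition.one_of_one_le, Real.smoothTransition.one_of_one_le, one_mul]
  · have : 0 ≤ (r - x) / δ := div_nonneg (by linarith) hδ.le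
    linarith
  · have : 0 ≤ (x - l) / δ := div_nonneg (by linarith) hδ.le
    linarith

/-- The plateau bump vanishes to the left of `l - δ`. [folklore] -/
theorem plateauBump_eq_zero_of_le {l r δ x : ℝ} (hδ : 0 < δ) (hx : x ≤ l - δ) :
    plateauBump l r δ x = 0 := by
  unfold plateauBump
  rw [Real.smoothTransition.zero_of_nonpos, zero_mul]
  have : (x - l) / δ ≤ -1 := by
    rw [div_le_iff₀ hδ]
    linarith
  linarith

/-- The plateau bump vanishes to the right of `r + δ`. [folklore] -/
theorem plateauBump_eq_zero_of_ge {l r δ x : ℝ} (hδ : 0 < δ) (hx : r + δ ≤ x) :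
    plateauBump l r δ x = 0 := by
  unfold plateauBump
  rw [mul_comm, Real.smoothTransition.zero_of_nonpos, zero_mul]
  have : (r - x) / δ ≤ -1 := by
    rw [div_le_iff₀ hδ]
    linarith
  linarith

/-- **Angular bump on the circle** about `circlePoint c`: `1` on the closed arc `circleClosedArc c α`, `0`
where `angCos c ≤ cos β` (for `cos β < cos α`), values in `[0, 1]`. [folklore] -/
def angBump (c α β : ℝ) (u : 𝕊 1) : ℝ :=
  Real.smoothTransition ((angCos c u - Real.cos β) / (Real.cos α - Real.cos β))

/-- The angular bump at `circlePoint θ`. [folklore] -/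
theorem angBump_circlePoint (c α β θ : ℝ) :
    angBump c α β (circlePoint θ) =
      Real.smoothTransition ((Real.cos (θ - c) - Real.cos β) / (Real.cos α - Real.cos β)) := by
  rw [angBump, angCos_circlePoint]

/-- The angular bump is smooth on the circle. [folklore] -/
theorem contMDiff_angBump (c α β : ℝ) : ContMDiff (𝓡 1) 𝓘(ℝ, ℝ) ∞ (angBump c α β) := by
  have h : ContDiff ℝ ∞ fun y : ℝ =>
      Real.smoothTransition ((y - Real.cos β) / (Real.cos α - Real.cos β)) :=
    Real.smoothTransition.contDiff.comp ((contDiff_id.sub contDiff_const).div_const _)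
  exact h.contMDiff.comp (contMDiff_angCos c)

/-- The angular bump is continuous. [folklore] -/
theorem continuous_angBump (c α β : ℝ) : Continuous (angBump c α β) :=
  (contMDiff_angBump c α β).continuous

/-- The angular bump is nonnegative. [folklore] -/
theorem angBump_nonneg (c α β : ℝ) (u : 𝕊 1) : 0 ≤ angBump c α β u :=
  Real.smoothTransition.nonneg _

/-- The angular bump is at most `1`. [folklore] -/
theorem angBump_le_one (c α β : ℝ) (u : 𝕊 1) : angBump c α β u ≤ 1 :=
  Real.smoothTransition.le_one _

/-- The angular bump is `1` on the closed arc `circleClosedArc c α` (`cos β < cos α`). [folklore] -/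
theorem angBump_eq_one {c α β : ℝ} (hαβ : Real.cos β < Real.cos α) {u : 𝕊 1}
    (hu : u ∈ circleClosedArc c α) : angBump c α β u = 1 := by
  unfold angBump
  apply Real.smoothTransition.one_of_one_le
  rw [le_div_iff₀ (by linarith), one_mul]
  have := mem_circleClosedArc.1 hu
  linarith

/-- The angular bump vanishes where `angCos c ≤ cos β` (`cos β < cos α`). [folklore] -/
theorem angBump_eq_zero {c α β : ℝ} (hαβ : Real.cos β < Real.cos α) {u : 𝕊 1}
    (hu : angCos c u ≤ Real.cos β) : angBump c α β u = 0 := by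
  unfold angBump
  apply Real.smoothTransition.zero_of_nonpos
  exact div_nonpos_of_nonpos_of_nonneg (by linarith) (by linarith)

/-- **Rectangle bump on `ℝ × S¹`**: the product of the plateauBump bump of `[τ - δ, τ + δ]` and the
angular bump of `circleClosedArc c α` (vanishing beyond angle `2α`). [folklore] -/
def rectBump (τ δ c α : ℝ) (p : ℝ × 𝕊 1) : ℝ :=
  plateauBump (τ - δ) (τ + δ) δ p.1 * angBump c α (2 * α) p.2

/-- Unfolding of `rectBump`. [folklore] -/
theorem rectBump_apply (τ δ c α : ℝ) (p : ℝ × 𝕊 1) :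
    rectBump τ δ c α p = plateauBump (τ - δ) (τ + δ) δ p.1 * angBump c α (2 * α) p.2 := rfl

/-- The rectangle bump is smooth. [folklore] -/
theorem contMDiff_rectBump (τ δ c α : ℝ) :
    ContMDiff (𝓘(ℝ, ℝ).prod (𝓡 1)) 𝓘(ℝ, ℝ) ∞ (rectBump τ δ c α) :=
  ((contDiff_plateauBump _ _ _).contMDiff.comp contMDiff_fst).smul
    ((contMDiff_angBump c α (2 * α)).comp contMDiff_snd)

/-- The rectangle bump is continuous. [folklore] -/
theorem continuous_rectBump (τ δ c α : ℝ) : Continuous (rectBump τ δ c α) :=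
  (contMDiff_rectBump τ δ c α).continuous

/-- The rectangle bump is nonnegative. [folklore] -/
theorem rectBump_nonneg (τ δ c α : ℝ) (p : ℝ × 𝕊 1) : 0 ≤ rectBump τ δ c α p :=
  mul_nonneg (plateauBump_nonneg _ _ _ _) (angBump_nonneg _ _ _ _)

/-- The rectangle bump is at most `1`. [folklore] -/
theorem rectBump_le_one (τ δ c α : ℝ) (p : ℝ × 𝕊 1) : rectBump τ δ c α p ≤ 1 :=
  mul_le_one₀ (plateauBump_le_one _ _ _ _) (angBump_nonneg _ _ _ _) (angBump_le_one _ _ _ _)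

/-- `|rectBump| ≤ 1`. [folklore] -/
theorem abs_rectBump_le_one (τ δ c α : ℝ) (p : ℝ × 𝕊 1) : |rectBump τ δ c α p| ≤ 1 := by
  rw [abs_of_nonneg (rectBump_nonneg _ _ _ _ _)]
  exact rectBump_le_one _ _ _ _ _

/-- For `0 < α` and `2α ≤ π` one has `cos (2α) < cos α`. [folklore] -/
theorem cos_two_mul_lt_cos {α : ℝ} (hα : 0 < α) (h2α : 2 * α ≤ π) :
    Real.cos (2 * α) < Real.cos α :=
  Real.cos_lt_cos_of_nonneg_of_le_pi hα.le h2α (by linarith)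

/-- The rectangle bump is `1` on the compact rectangle `[τ - δ, τ + δ] × circleClosedArc c α`. [folklore] -/
theorem rectBump_eq_one {τ δ c α : ℝ} (hδ : 0 < δ) (hα : 0 < α) (h2α : 2 * α ≤ π)
    {p : ℝ × 𝕊 1} (ht : p.1 ∈ Icc (τ - δ) (τ + δ)) (hu : p.2 ∈ circleClosedArc c α) :
    rectBump τ δ c α p = 1 := by
  rw [rectBump_apply, plateauBump_eq_one hδ ht.1 ht.2, angBump_eq_one (cos_two_mul_lt_cos hα h2α) hu,
    one_mul]

/-- The rectangle bump vanishes outside the time interval `(τ - 2δ, τ + 2δ)`. [folklore] -/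
theorem rectBump_eq_zero_of_time {τ δ c α : ℝ} (hδ : 0 < δ) {p : ℝ × 𝕊 1}
    (ht : p.1 ∉ Ioo (τ - 2 * δ) (τ + 2 * δ)) : rectBump τ δ c α p = 0 := by
  rw [rectBump_apply]
  rcases le_or_gt p.1 (τ - 2 * δ) with h | h
  · rw [plateauBump_eq_zero_of_le hδ (by linarith), zero_mul]
  · have h' : τ + 2 * δ ≤ p.1 := by
      by_contra hc
      exact ht ⟨h, lt_of_not_ge hc⟩
    rw [plateauBump_eq_zero_of_ge hδ (by linarith), zero_mul]

/-- The rectangle bump vanishes beyond the angle `2α` (`0 < α`, `2α ≤ π`). [folklore] -/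
theorem rectBump_eq_zero_of_angle {τ δ c α : ℝ} (hα : 0 < α) (h2α : 2 * α ≤ π) {p : ℝ × 𝕊 1}
    (hu : angCos c p.2 ≤ Real.cos (2 * α)) : rectBump τ δ c α p = 0 := by
  rw [rectBump_apply, angBump_eq_zero (cos_two_mul_lt_cos hα h2α) hu, mul_zero]

/-- **Support of the rectangle bump**: `tsupport ⊆ [τ - 2δ, τ + 2δ] × circleClosedArc c (2α)`. [folklore] -/
theorem tsupport_rectBump_subset {τ δ c α : ℝ} (hδ : 0 < δ) (hα : 0 < α) (h2α : 2 * α ≤ π) :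
    tsupport (rectBump τ δ c α) ⊆ Icc (τ - 2 * δ) (τ + 2 * δ) ×ˢ circleClosedArc c (2 * α) := by
  refine closure_minimal ?_ (isClosed_Icc.prod (isClosed_circleClosedArc _ _))
  intro p hp
  rw [mem_support] at hp
  constructor
  · by_contra ht
    exact hp (rectBump_eq_zero_of_time hδ fun h => ht (Ioo_subset_Icc_self h))
  · by_contra hu
    rw [mem_circleClosedArc, not_le] at hu
    exact hp (rectBump_eq_zero_of_angle hα h2α hu.le)

/-- The rectangle bump has compact support. [folklore] -/
theorem hasCompactSupport_rectBump {τ δ c α : ℝ} (hδ : 0 < δ) (hα : 0 < α) (h2α : 2 * α ≤ π) :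
    HasCompactSupport (rectBump τ δ c α) :=
  HasCompactSupport.of_support_subset_isCompact (isCompact_Icc.prod (isCompact_circleClosedArc c (2 * α)))
    ((subset_tsupport _).trans (tsupport_rectBump_subset hδ hα h2α))

/-- **Lift of the rectangle bump** to `ℝ²`: smooth in the vector-space sense. [folklore] -/
theorem contDiff_rectBump_lift (τ δ c α : ℝ) :
    ContDiff ℝ ∞ fun q : ℝ × ℝ => rectBump τ δ c α (q.1, circlePoint q.2) := by
  have h : (fun q : ℝ × ℝ => rectBump τ δ c α (q.1, circlePoint q.2)) = fun q : ℝ × ℝ =>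
      plateauBump (τ - δ) (τ + δ) δ q.1 *
        Real.smoothTransition ((Real.cos (q.2 - c) - Real.cos (2 * α)) /
          (Real.cos α - Real.cos (2 * α))) := by
    funext q
    rw [rectBump_apply, angBump_circlePoint]
  rw [h]
  refine ((contDiff_plateauBump _ _ _).comp contDiff_fst).mul ?_
  exact Real.smoothTransition.contDiff.comp
    ((((Real.contDiff_cos.comp (contDiff_snd.sub contDiff_const)).sub contDiff_const)).div_const _)

end Bumps

/-! ### Perturbation of a family inside a chart -/

section Perturb

variable [TopologicalSpace V] [ChartedSpace (𝔼 n) V]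

open Classical in
/-- **Perturbation of the family `G` inside the extended chart at `x`** by the affine term
`ρ p • (v + ℓ p.2 • w)`, `q = (v, w) ∈ ℝⁿ × ℝⁿ`: where `ρ p ≠ 0` the point `G p` is moved, in
the coordinates of the extended chart `φ` at `x`, to `φ⁻¹ (φ (G p) + ρ p • (v + ℓ p.2 • w))`;
where `ρ p = 0` it is left alone.  (Whitney (1936), §8: local modification of a map by small
polynomial terms in a coordinate system; here the terms are of degree `≤ 1` in a coordinate
function `ℓ` of the circle.) [folklore] -/
def chartPerturb (G : ℝ × 𝕊 1 → V) (x : V) (ρ : ℝ × 𝕊 1 → ℝ) (ℓ : 𝕊 1 → ℝ) (q : 𝔼 n × 𝔼 n)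
    (p : ℝ × 𝕊 1) : V :=
  if ρ p = 0 then G p
  else (extChartAt (𝓡 n) x).symm (extChartAt (𝓡 n) x (G p) + ρ p • (q.1 + ℓ p.2 • q.2))

variable {G : ℝ × 𝕊 1 → V} {x : V} {ρ : ℝ × 𝕊 1 → ℝ} {ℓ : 𝕊 1 → ℝ} {q : 𝔼 n × 𝔼 n}

/-- Where the bump vanishes the perturbation does nothing. [folklore] -/
theorem chartPerturb_of_eq_zero {p : ℝ × 𝕊 1} (h : ρ p = 0) : chartPerturb G x ρ ℓ q p = G p := by
  simp [chartPerturb, h]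

/-- On the chart source the perturbation is given by the chart formula (also where `ρ p = 0`).
[folklore] -/
theorem chartPerturb_eq_of_mem_source {p : ℝ × 𝕊 1} (h : G p ∈ (chartAt (𝔼 n) x).source) :
    chartPerturb G x ρ ℓ q p =
      (extChartAt (𝓡 n) x).symm (extChartAt (𝓡 n) x (G p) + ρ p • (q.1 + ℓ p.2 • q.2)) := by
  by_cases hρ : ρ p = 0
  · rw [chartPerturb_of_eq_zero hρ, hρ, zero_smul, add_zero]
    exact ((extChartAt (𝓡 n) x).left_inv (by rwa [extChartAt_source])).symm
  · simp [chartPerturb, hρ]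

/-- With parameter `q = 0` the perturbation does nothing. [folklore] -/
theorem chartPerturb_zero (hsrc : ∀ p, ρ p ≠ 0 → G p ∈ (chartAt (𝔼 n) x).source) :
    chartPerturb G x ρ ℓ (0 : 𝔼 n × 𝔼 n) = G := by
  funext p
  by_cases hρ : ρ p = 0
  · exact chartPerturb_of_eq_zero hρ
  · rw [chartPerturb_eq_of_mem_source (hsrc p hρ)]
    simp only [Prod.fst_zero, Prod.snd_zero, smul_zero, add_zero]
    exact (extChartAt (𝓡 n) x).left_inv (by rw [extChartAt_source]; exact hsrc p hρ)

/-- Off the topological support of the bump the perturbed family agrees with `G` near the point.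
[folklore] -/
theorem chartPerturb_eventuallyEq {p : ℝ × 𝕊 1} (hp : p ∉ tsupport ρ) :
    chartPerturb G x ρ ℓ q =ᶠ[𝓝 p] G := by
  have h : ρ =ᶠ[𝓝 p] 0 := notMem_tsupport_iff_eventuallyEq.1 hp
  filter_upwards [h] with p' hp'
  exact chartPerturb_of_eq_zero hp'

/-- At a point of the chart source whose perturbed coordinates stay in the chart target, the
perturbed point lies in the chart source and has the expected coordinates. [folklore] -/
theorem chartPerturb_mem_source {p : ℝ × 𝕊 1} (h : G p ∈ (chartAt (𝔼 n) x).source)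
    (ht : extChartAt (𝓡 n) x (G p) + ρ p • (q.1 + ℓ p.2 • q.2) ∈ (extChartAt (𝓡 n) x).target) :
    chartPerturb G x ρ ℓ q p ∈ (chartAt (𝔼 n) x).source ∧
      extChartAt (𝓡 n) x (chartPerturb G x ρ ℓ q p) =
        extChartAt (𝓡 n) x (G p) + ρ p • (q.1 + ℓ p.2 • q.2) := by
  rw [chartPerturb_eq_of_mem_source h]
  refine ⟨?_, (extChartAt (𝓡 n) x).right_inv ht⟩
  rw [← extChartAt_source (𝓡 n)]
  exact (extChartAt (𝓡 n) x).map_target ht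

variable [IsManifold (𝓡 n) ∞ V]

/-- **Smoothness of the perturbed family.**  If `G`, `ρ`, `ℓ` are smooth, `R ⊇ tsupport ρ` is an
open set mapped by `G` into the source of the chart at `x`, and the perturbed coordinates of the
points of `R` stay in the chart target, then `chartPerturb G x ρ ℓ q` is smooth: on `R` it is the
chart formula, off `tsupport ρ` it is `G`. [folklore] -/
theorem contMDiff_chartPerturb (hG : ContMDiff (𝓘(ℝ, ℝ).prod (𝓡 1)) (𝓡 n) ∞ G)
    (hρ : ContMDiff (𝓘(ℝ, ℝ).prod (𝓡 1)) 𝓘(ℝ, ℝ) ∞ ρ) (hℓ : ContMDiff (𝓡 1) 𝓘(ℝ, ℝ) ∞ ℓ)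
    {R : Set (ℝ × 𝕊 1)} (hR : IsOpen R) (hsupp : tsupport ρ ⊆ R)
    (hsrc : MapsTo G R (chartAt (𝔼 n) x).source)
    (htgt : ∀ p ∈ R, extChartAt (𝓡 n) x (G p) + ρ p • (q.1 + ℓ p.2 • q.2) ∈
      (extChartAt (𝓡 n) x).target) :
    ContMDiff (𝓘(ℝ, ℝ).prod (𝓡 1)) (𝓡 n) ∞ (chartPerturb G x ρ ℓ q) := by
  -- the chart formula is smooth on `R`
  set F : ℝ × 𝕊 1 → V := fun p =>
    (extChartAt (𝓡 n) x).symm (extChartAt (𝓡 n) x (G p) + ρ p • (q.1 + ℓ p.2 • q.2)) with hF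
  have hinner : ContMDiffOn (𝓘(ℝ, ℝ).prod (𝓡 1)) 𝓘(ℝ, 𝔼 n) ∞
      (fun p : ℝ × 𝕊 1 => extChartAt (𝓡 n) x (G p) + ρ p • (q.1 + ℓ p.2 • q.2)) R := by
    have h1 : ContMDiffOn (𝓘(ℝ, ℝ).prod (𝓡 1)) 𝓘(ℝ, 𝔼 n) ∞
        (fun p : ℝ × 𝕊 1 => extChartAt (𝓡 n) x (G p)) R :=
      contMDiffOn_extChartAt.comp hG.contMDiffOn hsrc
    have h2 : ContMDiff (𝓘(ℝ, ℝ).prod (𝓡 1)) 𝓘(ℝ, 𝔼 n) ∞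
        (fun p : ℝ × 𝕊 1 => ρ p • (q.1 + ℓ p.2 • q.2)) := by
      refine hρ.smul ?_
      exact contMDiff_const.add (((hℓ.comp contMDiff_snd)).smul contMDiff_const)
    exact h1.add h2.contMDiffOn
  have hFR : ContMDiffOn (𝓘(ℝ, ℝ).prod (𝓡 1)) (𝓡 n) ∞ F R :=
    (contMDiffOn_extChartAt_symm x).comp hinner htgt
  intro p
  by_cases hp : p ∈ R
  · have heq : chartPerturb G x ρ ℓ q =ᶠ[𝓝 p] F := by
      filter_upwards [hR.mem_nhds hp] with p' hp'
      exact chartPerturb_eq_of_mem_source (hsrc hp')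
    exact ((hFR.contMDiffAt (hR.mem_nhds hp)).congr_of_eventuallyEq heq)
  · have hp' : p ∉ tsupport ρ := fun h => hp (hsupp h)
    exact (hG p).congr_of_eventuallyEq (chartPerturb_eventuallyEq hp')

end Perturb

end Literature.Topology.FourManifolds
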